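import Literature.AlgebraicGeometry.HodgeTheory.WeilClassesTensorPointField
import Literature.AlgebraicGeometry.HodgeTheory.WeilClassesFieldSplitSquareZetaEight
import HarnessLib

/-!
# Companion tensor points: EVERY Weil class of `E = ℚ[x]/(P)` is algebraic (`weilClassesField ⊆ Nᵍ`)

Family `hodge`, layer `Literature/AlgebraicGeometry/HodgeTheory`. Completes `WeilClassesTensorPointField` (a non-zero algebraic class
`P_ρ` on the Weil line of every root `ρ`) exactly as `WeilClassesFieldSplitSquareZetaEight` completed the `ζ₈` file: for a companion
tensor structure `(A, φ, q₀..q_n; u; s₀)` of `P = x^{n+1} + Σ a_j xʲ` over `T` (`dim T = g ≥ 1`) with, IN ADDITION, `dim A = (n+1)·g`,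
the section `s₀` killing `q₁, …, q_n`, and `n + 1` DISTINCT complex roots `r₀, …, r_n` of `P` (so `P` is separable — every irreducible `P`,
in particular the minimal polynomial of a generator of a CM field):

* `finrank_eigenspace_eq_of_companion` — `φ^*` on `H¹(A(ℂ); ℂ)` is semisimple, its eigenvalues are the `r_k`, each with multiplicity
  EXACTLY `2g` (the `n+1` injective maps `v ↦ w_{r_k}(v) = Σ_j r_kʲ q_j^*v` land in independent eigenspaces and `b₁(A) = 2(n+1)g`);
* `pullbackEigenclasses_le_algebraicClasses_of_companion` — **every Weil line `⋀^{2g}V_ρ` is contained in the algebraic classes**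
  (a line by `finrank_pullbackEigenclasses_pow_le_one`, spanned by the algebraic `P_ρ` of `exists_mem_weilLine_algebraic_ne_zero_of_companion`
  for `ρ = r_k`, zero otherwise);
* `weilClassesField_le_algebraicClasses_of_companion` — **`weilClassesField A φ P' (2g) ⊆ algebraicClasses A.X g` for EVERY `P' ∈ ℤ[x]`**:
  Deligne's Lemma 4.5 / Remark 4.10 (`A₀ ⊗ E`, `E` ANY number field) on the real carriers — the body of the ladder's rung R3
  (`WeilTypeLadder.WeilClassesCMField`, `e = n+1 > 2`, `m = g`) at the companion tensor points of EVERY CM field, with no rationality /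
  Hodge-type hypothesis needed. Fact-free; not a rung (special points: the `g(g+1)/2`-dimensional locus `{T ⊗ E}`).

## References

* [Deligne1982HodgeCycles] P. Deligne, LNM 900 (1982), §4 (4.3)–(4.4) (the decomposition `(⋀_E H¹) ⊗ ℂ = ⊕_σ ⋀ H¹_σ`, multiplicities), Lemma 4.5, Remark 4.10, Thm. 4.8.
* [MoonenZarhin1998WeilClasses] B. Moonen, Yu. Zarhin, Weil classes on abelian varieties (1998), §1.
-/

noncomputable section

open CategoryTheory

namespace Literature.AlgebraicGeometry.HodgeTheory

open Literature.AlgebraicTopology.SingularHomology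
open Literature.AlgebraicGeometry.Motives

section HodgeTheory

variable {A T : Motives.AbelianVariety ℂ} {g n : ℕ} {φ : A ⟶ A} {q : Fin (n + 1) → (A ⟶ T)} {a : Fin (n + 1) → ℤ}
  {r : Fin (n + 1) → ℂ}

/-- **Multiplicities at a companion tensor point.** If `dim T = g`, `dim A = (n+1)g`, the `q_j` satisfy the companion relations of
`P = x^{n+1} + Σ a_j xʲ` for `φ`, `s₀` is a section of `q₀` killing `q₁..q_n`, and `r₀..r_n` are `n+1` DISTINCT roots of `P`, then `φ^*`
on `H¹(A(ℂ); ℂ)` is semisimple, `⊕_k V_{r_k} = H¹(A)`, every `V_{r_k}` has dimension `2g`, and every other `ρ` is not an eigenvalue.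
[cite: Deligne1982HodgeCycles, §4 (4.3)–(4.4) and Thm. 4.8] -/
theorem finrank_eigenspace_eq_of_companion (hT : T.dim = g) (hA : A.dim = (n + 1) * g)
    (hq0 : φ ≫ q 0 = -(a 0 • q (Fin.last n)))
    (hqs : ∀ j : Fin n, φ ≫ q j.succ = q (Fin.castSucc j) - a j.succ • q (Fin.last n))
    {s₀ : T ⟶ A} (hs₀ : s₀ ≫ q 0 = 𝟙 T) (hs₀' : ∀ j : Fin n, s₀ ≫ q j.succ = 0)
    (hr : Function.Injective r) (hroot : ∀ k, r k ^ (n + 1) + ∑ j : Fin (n + 1), (a j : ℂ) * r k ^ (j : ℕ) = 0) :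
    Module.End.IsSemisimple (complexBetti.map φ.hom.hom.hom 1).hom ∧
      (∀ k, Module.finrank ℂ (Module.End.eigenspace (complexBetti.map φ.hom.hom.hom 1).hom (r k)) = 2 * g) ∧
      (∀ ρ, ρ ∉ Set.range r → Module.End.eigenspace (complexBetti.map φ.hom.hom.hom 1).hom ρ = ⊥) := by
  classical
  haveI := finite_complexBetti_abelianVariety A 1
  haveI := finite_complexBetti_abelianVariety T 1
  set Tφ : Module.End ℂ (complexBetti A.X 1) := (complexBetti.map φ.hom.hom.hom 1).hom with hTφ
  have hb₁T : Module.finrank ℂ (complexBetti T.X 1) = 2 * g := by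
    rw [AbelianVariety.finrank_complexBetti_one, hT]
  have hb₁A : Module.finrank ℂ (complexBetti A.X 1) = (n + 1) * (2 * g) := by
    rw [AbelianVariety.finrank_complexBetti_one, hA]; ring
  -- lower bound `2g ≤ dim V_{r k}`: the injective map `v ↦ w_{r k}(v)`
  have hlow : ∀ k, 2 * g ≤ Module.finrank ℂ (Tφ.eigenspace (r k)) := by
    intro k
    let L : complexBetti T.X 1 →ₗ[ℂ] complexBetti A.X 1 :=
      ∑ j : Fin (n + 1), r k ^ (j : ℕ) • (complexBetti.map (q j).hom.hom.hom 1).hom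
    have hLapply : ∀ v, L v = ∑ j : Fin (n + 1), r k ^ (j : ℕ) • complexBetti.map (q j).hom.hom.hom 1 v := by
      intro v
      simp only [L, LinearMap.sum_apply, LinearMap.smul_apply]
    have hsec : ∀ v, complexBetti.map s₀.hom.hom.hom 1 (L v) = v := by
      intro v
      rw [hLapply, map_sum, Fin.sum_univ_succ]
      simp only [map_smul]
      have e0 : complexBetti.map s₀.hom.hom.hom 1 (complexBetti.map (q 0).hom.hom.hom 1 v) = v := by
        rw [complexBetti_map_map_hom, hs₀]; exact abelianVariety_map_id_apply v
      have es : ∀ j : Fin n, complexBetti.map s₀.hom.hom.hom 1 (complexBetti.map (q j.succ).hom.hom.hom 1 v) = 0 := by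
        intro j; rw [complexBetti_map_map_hom, hs₀' j, complexBetti_map_zero_deg_one]
      simp only [e0, es, smul_zero, Finset.sum_const_zero, add_zero, Fin.val_zero, pow_zero, one_smul]
    have hinj : Function.Injective L := fun v w hvw => by
      have h := congrArg (complexBetti.map s₀.hom.hom.hom 1) hvw
      rwa [hsec, hsec] at h
    have hrange : LinearMap.range L ≤ Tφ.eigenspace (r k) := by
      rintro _ ⟨v, rfl⟩
      rw [hLapply]
      exact sum_pow_smul_map_mem_eigenspace_of_companion hq0 hqs (hroot k) v
    calc 2 * g = Module.finrank ℂ (LinearMap.range L) := by rw [LinearMap.finrank_range_of_inj hinj, hb₁T]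
      _ ≤ Module.finrank ℂ (Tφ.eigenspace (r k)) := Submodule.finrank_mono hrange
  -- independence and the dimension count: `⊕_k V_{r k} = H¹(A)`, each of dimension `2g`
  have hind : iSupIndep fun k => Tφ.eigenspace (r k) := Tφ.eigenspaces_iSupIndep.comp hr
  have hsup : Module.finrank ℂ (⨆ k, Tφ.eigenspace (r k) : Submodule ℂ (complexBetti A.X 1)) =
      ∑ k, Module.finrank ℂ (Tφ.eigenspace (r k)) := by
    rw [Submodule.iSup_eq_range_dfinsupp_lsum, LinearMap.finrank_range_of_inj hind.dfinsupp_lsum_injective]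
    exact Module.finrank_directSum (R := ℂ) fun k => (Tφ.eigenspace (r k))
  have hsum_le : ∑ k, Module.finrank ℂ (Tφ.eigenspace (r k)) ≤ (n + 1) * (2 * g) := by
    rw [← hsup, ← hb₁A]; exact Submodule.finrank_le _
  have heq : ∀ k, Module.finrank ℂ (Tφ.eigenspace (r k)) = 2 * g := by
    have hle : ∀ k ∈ (Finset.univ : Finset (Fin (n + 1))), 2 * g ≤ Module.finrank ℂ (Tφ.eigenspace (r k)) :=
      fun k _ => hlow k
    have hge : ∑ _k : Fin (n + 1), 2 * g ≤ ∑ k, Module.finrank ℂ (Tφ.eigenspace (r k)) := Finset.sum_le_sum hle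
    have hs : ∑ _k : Fin (n + 1), 2 * g = ∑ k, Module.finrank ℂ (Tφ.eigenspace (r k)) := by
      refine le_antisymm hge ?_
      rw [Finset.sum_const, Finset.card_univ, Fintype.card_fin, smul_eq_mul]
      exact hsum_le
    intro k
    exact ((Finset.sum_eq_sum_iff_of_le hle).mp hs k (Finset.mem_univ k)).symm
  have htop : (⨆ k, Tφ.eigenspace (r k) : Submodule ℂ (complexBetti A.X 1)) = ⊤ := by
    refine Submodule.eq_top_of_finrank_eq ?_
    rw [hsup, hb₁A, Finset.sum_congr rfl fun k _ => heq k, Finset.sum_const, Finset.card_univ, Fintype.card_fin,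
      smul_eq_mul]
  -- no other eigenvalues
  have hother : ∀ ρ, ρ ∉ Set.range r → Tφ.eigenspace ρ = ⊥ := by
    intro ρ hρ
    have hdis := Tφ.eigenspaces_iSupIndep ρ
    have hle : (⨆ k, Tφ.eigenspace (r k) : Submodule ℂ (complexBetti A.X 1)) ≤ ⨆ (ν : ℂ) (_ : ν ≠ ρ), Tφ.eigenspace ν :=
      iSup_le fun k => le_iSup₂_of_le (r k) (fun h => hρ ⟨k, h⟩) le_rfl
    rw [htop, top_le_iff] at hle
    rw [hle, disjoint_top] at hdis
    exact hdis
  -- semisimplicity: the separable `∏_k (X - r_k)` annihilates `H¹(A)`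
  have hss : Tφ.IsSemisimple := by
    let p : Polynomial ℂ := ∏ k, (Polynomial.X - Polynomial.C (r k))
    have hsep : p.Separable := Polynomial.separable_prod_X_sub_C_iff.mpr hr
    refine Module.End.isSemisimple_of_squarefree_aeval_eq_zero hsep.squarefree ?_
    refine LinearMap.ext fun v => ?_
    rw [LinearMap.zero_apply]
    have hv : v ∈ (⨆ k, Tφ.eigenspace (r k) : Submodule ℂ (complexBetti A.X 1)) := by rw [htop]; exact Submodule.mem_top
    refine Submodule.iSup_induction (fun k => Tφ.eigenspace (r k)) (motive := fun w => Polynomial.aeval Tφ p w = 0) hv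
      ?_ (map_zero _) (fun x y hx hy => by rw [map_add, hx, hy, add_zero])
    intro k w hw
    have hsplit : p = (∏ j ∈ Finset.univ.erase k, (Polynomial.X - Polynomial.C (r j))) * (Polynomial.X - Polynomial.C (r k)) :=
      (Finset.prod_erase_mul Finset.univ (fun j => Polynomial.X - Polynomial.C (r j)) (Finset.mem_univ k)).symm
    rw [hsplit, map_mul, Module.End.mul_apply, map_sub, Polynomial.aeval_X, Polynomial.aeval_C, LinearMap.sub_apply,
      Module.algebraMap_end_apply, (Module.End.mem_eigenspace_iff.mp hw), sub_self, map_zero]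
  exact ⟨hss, heq, hother⟩

/-- **Every Weil line at a companion tensor point is algebraic.** Under the hypotheses of `finrank_eigenspace_eq_of_companion` plus the
separating endomorphism `u` (`u ≫ q_j = 2ʲ·q_j`): for EVERY `ρ`, `pullbackEigenclasses A φ (2g) ((x + yρ)^{2g}) ≤ algebraicClasses A.X g`
(a line spanned by the algebraic `P_ρ` for `ρ = r_k`; `⊥` otherwise). [cite: Deligne1982HodgeCycles, §4 Lemma 4.5, Remark 4.10] -/
theorem pullbackEigenclasses_le_algebraicClasses_of_companion (hg : 0 < g) (hT : T.dim = g) (hA : A.dim = (n + 1) * g)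
    (hq0 : φ ≫ q 0 = -(a 0 • q (Fin.last n)))
    (hqs : ∀ j : Fin n, φ ≫ q j.succ = q (Fin.castSucc j) - a j.succ • q (Fin.last n))
    {u : A ⟶ A} (hu : ∀ j : Fin (n + 1), u ≫ q j = (2 ^ (j : ℕ)) • q j)
    {s₀ : T ⟶ A} (hs₀ : s₀ ≫ q 0 = 𝟙 T) (hs₀' : ∀ j : Fin n, s₀ ≫ q j.succ = 0)
    (hr : Function.Injective r) (hroot : ∀ k, r k ^ (n + 1) + ∑ j : Fin (n + 1), (a j : ℂ) * r k ^ (j : ℕ) = 0) (ρ : ℂ) :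
    pullbackEigenclasses A φ (2 * g) (fun x y => ((x : ℂ) + (y : ℂ) * ρ) ^ (2 * g)) ≤ algebraicClasses A.X g := by
  classical
  haveI := finite_complexBetti_abelianVariety A (2 * g)
  haveI := finite_complexBetti_abelianVariety A 1
  obtain ⟨hss, heq, hother⟩ := finrank_eigenspace_eq_of_companion hT hA hq0 hqs hs₀ hs₀' hr hroot
  by_cases hρ : ρ ∈ Set.range r
  · obtain ⟨k, rfl⟩ := hρ
    obtain ⟨hle1, -⟩ := finrank_pullbackEigenclasses_pow_le_one (N := 2 * g) hss (r k) (heq k).le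
    obtain ⟨P, hPeig, hPalg, hP0⟩ := exists_mem_weilLine_algebraic_ne_zero_of_companion hg hT hq0 hqs hu hs₀ (hroot k)
    exact le_of_finrank_le_one_of_mem hle1 hPeig hP0 hPalg
  · have h0 : Module.finrank ℂ (Module.End.eigenspace (complexBetti.map φ.hom.hom.hom 1).hom ρ) = 0 := by
      rw [hother ρ hρ, finrank_bot]
    obtain ⟨-, hbot⟩ := finrank_pullbackEigenclasses_pow_le_one (N := 2 * g) hss ρ (by rw [h0]; exact Nat.zero_le _)
    rw [hbot (by rw [h0]; omega)]
    exact bot_le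

/-- **Deligne's Lemma 4.5 at companion tensor points, for every number field: all Weil classes are algebraic.** Under the same
hypotheses, `weilClassesField A φ P' (2g) ≤ algebraicClasses A.X g` for EVERY `P' ∈ ℤ[x]` (the Weil space of Moonen–Zarhin §1 is a sum
of Weil lines, each algebraic) — the body of rung R3 (`WeilClassesCMField`) at `(A, φ)`, with no rationality or Hodge-type hypothesis.
[cite: Deligne1982HodgeCycles, §4 Lemma 4.5, Remark 4.10] [cite: MoonenZarhin1998WeilClasses, §1] -/
theorem weilClassesField_le_algebraicClasses_of_companion (hg : 0 < g) (hT : T.dim = g) (hA : A.dim = (n + 1) * g)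
    (hq0 : φ ≫ q 0 = -(a 0 • q (Fin.last n)))
    (hqs : ∀ j : Fin n, φ ≫ q j.succ = q (Fin.castSucc j) - a j.succ • q (Fin.last n))
    {u : A ⟶ A} (hu : ∀ j : Fin (n + 1), u ≫ q j = (2 ^ (j : ℕ)) • q j)
    {s₀ : T ⟶ A} (hs₀ : s₀ ≫ q 0 = 𝟙 T) (hs₀' : ∀ j : Fin n, s₀ ≫ q j.succ = 0)
    (hr : Function.Injective r) (hroot : ∀ k, r k ^ (n + 1) + ∑ j : Fin (n + 1), (a j : ℂ) * r k ^ (j : ℕ) = 0)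
    (P' : Polynomial ℤ) :
    weilClassesField A φ P' (2 * g) ≤ algebraicClasses A.X g := by
  change (⨆ ρ ∈ {ρ : ℂ | Polynomial.eval₂ (Int.castRingHom ℂ) ρ P' = 0},
    pullbackEigenclasses A φ (2 * g) (fun x y => ((x : ℂ) + (y : ℂ) * ρ) ^ (2 * g))) ≤ _
  exact iSup₂_le fun ρ _ => pullbackEigenclasses_le_algebraicClasses_of_companion hg hT hA hq0 hqs hu hs₀ hs₀' hr hroot ρ

/-- Element form: every class of `weilClassesField A φ P' (2g)` — in particular every rational `(g,g)`-class, the shape of R3 — is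
algebraic at a companion tensor point. [cite: Deligne1982HodgeCycles, §4 Lemma 4.5, Remark 4.10] -/
theorem mem_algebraicClasses_of_mem_weilClassesField_of_companion (hg : 0 < g) (hT : T.dim = g) (hA : A.dim = (n + 1) * g)
    (hq0 : φ ≫ q 0 = -(a 0 • q (Fin.last n)))
    (hqs : ∀ j : Fin n, φ ≫ q j.succ = q (Fin.castSucc j) - a j.succ • q (Fin.last n))
    {u : A ⟶ A} (hu : ∀ j : Fin (n + 1), u ≫ q j = (2 ^ (j : ℕ)) • q j)
    {s₀ : T ⟶ A} (hs₀ : s₀ ≫ q 0 = 𝟙 T) (hs₀' : ∀ j : Fin n, s₀ ≫ q j.succ = 0)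
    (hr : Function.Injective r) (hroot : ∀ k, r k ^ (n + 1) + ∑ j : Fin (n + 1), (a j : ℂ) * r k ^ (j : ℕ) = 0)
    (P' : Polynomial ℤ) :
    ∀ c ∈ weilClassesField A φ P' (2 * g), IsRationalClass c → IsOfHodgeType A.dim A.X (2 * g) g g c →
      c ∈ algebraicClasses A.X g :=
  fun _ hc _ _ => weilClassesField_le_algebraicClasses_of_companion hg hT hA hq0 hqs hu hs₀ hs₀' hr hroot P' hc

end HodgeTheory

end Literature.AlgebraicGeometry.HodgeTheory

end
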